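import Summits.QuantumFields.YangMills.Theorems.BalabanUVNodesN19LipschitzLinksDegreeBudget
import Summits.QuantumFields.YangMills.Theorems.BalabanUVNodesN19SingleModeLowerBound
import Summits.QuantumFields.YangMills.Theorems.BalabanUVNodesN19OscillatingLinksMomentDiscrepancy
import Summits.QuantumFields.YangMills.Theorems.BalabanUVNodesN19KinkLowerBoundLawsCube

/-!
# YM-DAG node N19 (= NE7 proper) — THE GENERAL LIPSCHITZ ROW, TWO-SIDED, AND ITS LAW-LEVEL (`W₁`) FACE
# (`d∕(π(9t+6)) ≤ sup_{h 1-Lip} dist_∞(h∘S_d, Π_t) ≤ 10⁴·d·log₂³t∕t`; laws agreeing on `Π_t`: `2d∕(π(9t+6)) ≤ sup_h |∫h(S)d(P − Q)| ≤ 2·10⁴·d·log₂³t∕t`)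

Cell `pub-ymgap`, HUMAN RULING D-0062 (Track A) ∕ D-0149 (work-bound push), R141 (C) wider-strategy seat `pub-ymgap-dag-n19-e` (strategy
s3 = ALTERNATIVE CURRENCY), generation g33, module 6 (lineage module 153).  Route `Summits/QuantumFields/YangMills/Theses/BalabanUVNodes.lean`,
cluster item K3⁸ «SpineGivenEndpointR13SepCoPHV» (stmt-QuantumFields-27366); filed `--supports` that item `--as helper` (it proves no registered
stub).  COUNT-NEUTRAL: [folklore] over Mathlib and, BY NAME, the lineage's modules 152b `…N19LipschitzLinksDegreeBudget`
(`exists_mvPolynomial_near_lipschitzLink_l1Norm`), 134 `…N19SingleModeLowerBound` (`exists_le_abs_l1Norm_sub_eval`), 125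
`…N19OscillatingLinksMomentDiscrepancy` (`abs_integral_sub_integral_le_of_near`, `continuous_l1Norm`) and 137 `…N19KinkLowerBoundLawsCube`
(`exists_laws_equalMixedMoments_l1Norm`); TOY laws under HYPOTHESES; no scheme object, no Theses import; NOT a discharge claim.

THE ROW (CURRENCY-MAP v11 (v′), OPEN-PROBLEM.md «Statement» and «form 1 (W₁)»).  §1 ★★★ `lipschitzLinks_twoSided`: for every finite nonempty `ι`
(`d = |ι|`) and `t ≥ 2`: (UPPER, module 152b) every `K ≥ 0` and every `h` with `|h(s) − h(s′)| ≤ K|s − s′|` on `[0, d]` admit `P` of total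
degree `≤ t` with `|h(Σ|x_i|) − P(x)| ≤ 10⁴·K·d·log₂³t∕t` on `[−1,1]^ι`; (LOWER, module 134, the `1`-Lipschitz link `h = id`) every `P` of total
degree `≤ t` misses `Σ|x_i|` by `≥ d∕(π(9t+6))` somewhere on the cube.  READING: **`sup_{h 1-Lip} dist_∞(h∘S_d, Π_t) = Θ̃(d∕t)` uniformly in
`d` — between `d∕(π(9t+6))` and `10⁴·d·log₂³t∕t`** (before this generation the upper side was `d∕√t`).  §2 the law-level face: ★★
`abs_integral_lipschitzLink_l1Norm_sub_le_of_moments` (laws on the cube with equal mixed moments of total degree `≤ t`, `h` `K`-Lipschitz on `ℝ`: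
`|∫h(Σ|x_i|)dP − ∫h(Σ|x_i|)dQ| ≤ 2·10⁴·K·d·log₂³t∕t`) and ★★★ `laws_lipschitzLinks_twoSided` (with module 137's explicit pair: `∫Σ|x_i| d(Q − P) ≥
2d∕(π(9t+6))`): the Kantorovich–Rubinstein (`W₁`) distance between the laws of `Σ_i|x_i|` under two cube laws agreeing on `Π_t` is `Θ̃(d∕t)`.

HONEST FRAMING (binding).  Elementary and [folklore]; constants astronomical (`10⁴`, three logarithms: one Fejér, two ladder-budget); NO consumer in
the DAG today (an optimality map of the seat's own currency, degree model); nothing of Bałaban's instantiated; NE7 NOT PRINTED, NOT proved; N19 NOT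
discharged; count-neutral.  One finite `T⁴` programme at fixed `ε`; nothing continuum ∕ `ℝ⁴` ∕ OS ∕ mass-gap ∕ Clay.  0 `def` ∕ 0 `sorry`.
-/

noncomputable section

open Finset MeasureTheory
open scoped Real

namespace Summit.QuantumFields.YangMills.Theorems.BalabanUVNodesN19LipschitzLinksTwoSided

open Summit.QuantumFields.YangMills.Theorems.BalabanUVNodesN19LipschitzLinksDegreeBudget (exists_mvPolynomial_near_lipschitzLink_l1Norm)
open Summit.QuantumFields.YangMills.Theorems.BalabanUVNodesN19SingleModeLowerBound (exists_le_abs_l1Norm_sub_eval)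
open Summit.QuantumFields.YangMills.Theorems.BalabanUVNodesN19OscillatingLinksMomentDiscrepancy
  (abs_integral_sub_integral_le_of_near continuous_l1Norm)
open Summit.QuantumFields.YangMills.Theorems.BalabanUVNodesN19KinkLowerBoundLawsCube (exists_laws_equalMixedMoments_l1Norm)

variable {ι : Type*} [Fintype ι] [Nonempty ι]

/-! ## §1 ★★★ The general Lipschitz row, two-sided [folklore] -/

/-- ★★★ **THE GENERAL LIPSCHITZ ROW IS `Θ̃(d∕t)` (both sides in one declaration).**  For finite nonempty `ι` (`d = |ι|`) and `t ≥ 2`: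
(UPPER) for every `K ≥ 0` and every `h : ℝ → ℝ` with `|h(s) − h(s′)| ≤ K|s − s′|` on `[0, d]` there is `P : MvPolynomial ι ℝ` of total degree
`≤ t` with `|h(Σ_i|x_i|) − P(x)| ≤ 10⁴·K·d·(log₂t)³∕t` on `[−1,1]^ι` (module 152b); (LOWER) for every `P` of total degree `≤ t` some `x` in the
cube has `|Σ_i|x_i| − P(x)| ≥ d∕(π(9t+6))` (module 134; the `1`-Lipschitz link `h = id`).  CURRENCY-MAP (v′): the general class of Lipschitz
links of the ℓ¹-norm is at the ridge rate `d∕t` up to `log³t`, uniformly in `d`. [folklore] -/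
theorem lipschitzLinks_twoSided {t : ℕ} (ht : 2 ≤ t) :
    (∀ (K : ℝ) (h : ℝ → ℝ), 0 ≤ K →
      (∀ s s', s ∈ Set.Icc (0 : ℝ) (Fintype.card ι) → s' ∈ Set.Icc (0 : ℝ) (Fintype.card ι) → |h s - h s'| ≤ K * |s - s'|) →
      ∃ P : MvPolynomial ι ℝ, P.totalDegree ≤ t ∧
        ∀ x : ι → ℝ, (∀ i, x i ∈ Set.Icc (-1 : ℝ) 1) →
          |h (∑ i, |x i|) - MvPolynomial.eval x P| ≤ 10000 * K * Fintype.card ι * Real.logb 2 t ^ 3 / t) ∧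
    (∀ P : MvPolynomial ι ℝ, P.totalDegree ≤ t →
      ∃ x : ι → ℝ, (∀ i, x i ∈ Set.Icc (-1 : ℝ) 1) ∧
        Fintype.card ι / (π * (9 * t + 6)) ≤ |(∑ i, |x i|) - MvPolynomial.eval x P|) :=
  ⟨fun _ _ hK0 hK => exists_mvPolynomial_near_lipschitzLink_l1Norm hK0 hK ht,
    fun P hP => exists_le_abs_l1Norm_sub_eval (le_trans (by norm_num) ht) P hP⟩

/-! ## §2 ★★★ The law-level (`W₁`) face [folklore] -/

/-- ★★ **LAWS AGREEING ON `Π_t` INTEGRATE EVERY LIPSCHITZ LINK OF `Σ|x_i|` TO WITHIN `2·10⁴·K·d·log₂³t∕t`.**  Let `P, Q` be probability laws on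
`ℝ^ι` carried by `[−1,1]^ι` with equal mixed moments of total degree `≤ t` (`t ≥ 2`), and `h : ℝ → ℝ` with `|h(s) − h(s′)| ≤ K|s − s′|` on `ℝ`,
`K ≥ 0`.  Then `|∫h(Σ_i|x_i|)dP − ∫h(Σ_i|x_i|)dQ| ≤ 2·10⁴·K·d·(log₂t)³∕t` (module 125's transfer with §1's polynomial).  By Kantorovich–Rubinstein
duality: the `W₁` distance between the laws of `Σ_i|x_i|` under `P` and `Q` is `≤ 2·10⁴·d·log₂³t∕t` — OPEN-PROBLEM.md form 1, up to `log³`. [folklore] -/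
theorem abs_integral_lipschitzLink_l1Norm_sub_le_of_moments {P Q : Measure (ι → ℝ)} [IsProbabilityMeasure P] [IsProbabilityMeasure Q]
    (hP : P (Set.pi Set.univ (fun _ : ι => Set.Icc (-1 : ℝ) 1))ᶜ = 0) (hQ : Q (Set.pi Set.univ (fun _ : ι => Set.Icc (-1 : ℝ) 1))ᶜ = 0)
    {t : ℕ} (ht : 2 ≤ t) (hmom : ∀ j : ι → ℕ, ∑ i, j i ≤ t → ∫ x, ∏ i, x i ^ j i ∂P = ∫ x, ∏ i, x i ^ j i ∂Q)
    {h : ℝ → ℝ} {K : ℝ} (hK0 : 0 ≤ K) (hK : ∀ s s', |h s - h s'| ≤ K * |s - s'|) :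
    |∫ x, h (∑ i, |x i|) ∂P - ∫ x, h (∑ i, |x i|) ∂Q| ≤ 2 * (10000 * K * Fintype.card ι * Real.logb 2 t ^ 3 / t) := by
  obtain ⟨F, hF, happ⟩ := exists_mvPolynomial_near_lipschitzLink_l1Norm (ι := ι) hK0 (fun s s' _ _ => hK s s') ht
  have hLip : LipschitzWith (Real.toNNReal K) h := by
    refine LipschitzWith.of_dist_le_mul fun x y => ?_
    rw [Real.dist_eq, Real.dist_eq, Real.coe_toNNReal _ hK0]
    exact hK x y
  have hg : Continuous fun x : ι → ℝ => h (∑ i, |x i|) := hLip.continuous.comp continuous_l1Norm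
  exact abs_integral_sub_integral_le_of_near hP hQ hmom hg hF happ

/-- ★★★ **THE LAW-LEVEL ROW IS `Θ̃(d∕t)` (both sides in one declaration).**  For finite nonempty `ι` (`d = |ι|`) and `t ≥ 2`: (UPPER) every two
probability laws on `ℝ^ι` carried by `[−1,1]^ι` with equal mixed moments of total degree `≤ t` and every `K`-Lipschitz `h` on `ℝ` (`K ≥ 0`)
satisfy `|∫h(Σ|x_i|)dP − ∫h(Σ|x_i|)dQ| ≤ 2·10⁴·K·d·log₂³t∕t`; (LOWER, module 137) there IS such a pair with `∫Σ|x_i| dQ − ∫Σ|x_i| dP ≥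
2d∕(π(9t+6))` (the `1`-Lipschitz link `h = id`).  The `W₁` form of OPEN-PROBLEM.md (v′), two-sided up to `log³t` and constants. [folklore] -/
theorem laws_lipschitzLinks_twoSided {t : ℕ} (ht : 2 ≤ t) :
    (∀ P Q : Measure (ι → ℝ), IsProbabilityMeasure P → IsProbabilityMeasure Q →
      P (Set.pi Set.univ (fun _ : ι => Set.Icc (-1 : ℝ) 1))ᶜ = 0 → Q (Set.pi Set.univ (fun _ : ι => Set.Icc (-1 : ℝ) 1))ᶜ = 0 →
      (∀ j : ι → ℕ, ∑ i, j i ≤ t → ∫ x, ∏ i, x i ^ j i ∂P = ∫ x, ∏ i, x i ^ j i ∂Q) →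
      ∀ (K : ℝ) (h : ℝ → ℝ), 0 ≤ K → (∀ s s', |h s - h s'| ≤ K * |s - s'|) →
        |∫ x, h (∑ i, |x i|) ∂P - ∫ x, h (∑ i, |x i|) ∂Q| ≤ 2 * (10000 * K * Fintype.card ι * Real.logb 2 t ^ 3 / t)) ∧
    (∃ P Q : Measure (ι → ℝ), IsProbabilityMeasure P ∧ IsProbabilityMeasure Q ∧
      P (Set.pi Set.univ (fun _ : ι => Set.Icc (-1 : ℝ) 1))ᶜ = 0 ∧ Q (Set.pi Set.univ (fun _ : ι => Set.Icc (-1 : ℝ) 1))ᶜ = 0 ∧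
      (∀ j : ι → ℕ, ∑ i, j i ≤ t → ∫ x, ∏ i, x i ^ j i ∂P = ∫ x, ∏ i, x i ^ j i ∂Q) ∧
      2 * Fintype.card ι / (π * (9 * t + 6)) ≤ (∫ x, ∑ i, |x i| ∂Q) - ∫ x, ∑ i, |x i| ∂P) := by
  refine ⟨fun P Q iP iQ hP hQ hmom K h hK0 hK => ?_, exists_laws_equalMixedMoments_l1Norm (le_trans (by norm_num) ht)⟩
  exact abs_integral_lipschitzLink_l1Norm_sub_le_of_moments hP hQ ht hmom hK0 hK

end Summit.QuantumFields.YangMills.Theorems.BalabanUVNodesN19LipschitzLinksTwoSided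

end
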